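import Summits.MatrixMultiplication.MatrixMultiplication.Theorems.AbelianSTPPCensusFPQGenDefs

/-!
# Rule FPq at `p = 3` («FP3»): the level table and the full-class theorem

Cell mm-stpp (rung F-M1), theory lane «past the walls» (seat mm-stpp-theory, gen 19).  Census-silent STRUCTURE file about the
shape-level predicate `FPQ.FormOKG Λ 3 …` / `FPQ.AdmG Λ (3·|Λ|) …` of `AbelianSTPPCensusFPQGenDefs` (Pollard fibred over a subgroup
`P` of order `3`, classes indexed by any finite abelian label group `Λ ≃ H ⧸ P`).  HOME/mm-stpp-theory/FP3-NOTE.md.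

Why `p = 3` matters.  FPQ-NOTE §2/§6 (gen 18) dismissed `p ≤ 3` through the fractional-`W` ceiling `q²·φ̄(D/q)`; with INTEGER class
values `W ∈ {0,1,2,3}` the picture is different: at the near-uniform split every class with `W = 2` violates (F1) as soon as
`|X| + |Y| > 2q + 2·cap` (`q = |Λ| = M/3`), so `W ≤ 1` everywhere and `|Z′| ≤ q` — false whenever `3|Z′| > M`.  This is the case at
`606, 648 = 2³3⁴, 675 = 3³5²` in the T_E window and at the T_B wall list of record `7128 = 2³·3⁴·11`
(`(14,17,18)+(16,16,16)⁸+(14,15,15)`), all previously filed as «no FPq at all».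

What this file proves (all elementary, for ANY `Λ`, no `decide` over `Λ`):
* `three_key` — for values `a, b, W ≤ 3` some admissible Pollard level `τ` realises
  `pairFloor 3 a b τ = ⌊W·a·b/3⌋ + τ·(3 − W)` (64 cases); hence
* `three_floor_sum_le` — (F1) at `p = 3` implies `Σ_g ⌊W·u_g·v_{c−g}/3⌋ ≤ W·cap` for the target class `c` with `W` points;
* read at `W = 3 / 2 / 1`: `three_prod_sum_le_of_full` (`Σ u_g v_{c−g} ≤ 3·cap`), `three_active_le_of_full` (at most `3·cap` active pairs),
  `three_pairs_le_of_two` (pairs `(≥2, ≥1)` and `(≥1, ≥2)` number `≤ 2·cap`), `three_pairs_le_of_one` (pairs `(3,≥1)`, `(≥1,3)`, `(2,2)`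
  number `≤ cap`);
* global histogram consequences for one letter form `FormOKG Λ 3 cap vmin SU SV SW u v w`:
  `three_supports_le_of_full` (a full target class ⇒ `#supp u + #supp v ≤ |Λ| + 3·cap`),
  `three_totals_le_of_two` (a target class of value `2` ⇒ `SU + SV ≤ 2|Λ| + 2·cap + #{u = 3} + #{v = 3}`),
  `three_fulls_le_of_one` (a target class of value `1` ⇒ `#{u = 3} + #{v = 3} ≤ cap + #{u = 0} + #{v = 0}`);
* **`three_false_of_no_full`** — if `|Λ| < SW` and `2|Λ| + 2·cap < SU + SV` then the form has NO solution with all values `≤ 2`: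
  some class of `u`, `v` or `w` is FULL (a whole coset of `P` inside `X`, `Y` or `Z′`);
* **`admG_three_exists_full`** — the same read on `AdmG Λ M a b c` at `M = 3·|Λ|`: every admissible triple `(x, y, z)` has a full class
  as soon as `|Λ| < Σ c a` and `2|Λ| + 2·max b < Σ a b + Σ b c`.
Together with `three_supports_le_of_full` this is the structure any FP3 certificate starts from: full classes exist, and a full class of
one letter forces the supports of the other two to total at most `|Λ| + 3·cap`.
WHAT THIS IS NOT: no kill, no certificate, no census number, no `ω` statement; statements about the shape-level predicate only
(sound for STPP families through `FPQ.admG_of_isSTPP` / `FPQ.fpqGenSound`, file `AbelianSTPPCensusFPQGenSound`).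
-/

set_option linter.dupNamespace false -- `MatrixMultiplication.MatrixMultiplication` (summit = problem, D-0017)
set_option autoImplicit false

namespace Summit.MatrixMultiplication.MatrixMultiplication.Theorems

open Finset

namespace FPQ

/-! ### The level table at `p = 3` -/

/-- **Key identity of the `p = 3` table**: for `a, b, W ≤ 3` some admissible Pollard level `τ ≤ min a b` realises
`pairFloor 3 a b τ = ⌊W·a·b/3⌋ + τ·(3 − W)` (the optimal level: `min a b` when `W ≥ 2`; at `W = 1` level `0` for the products `1, 2`,
level `1` for the products `3, 4`, full level above; 64 cases, by `decide`). [original] -/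
theorem three_key : ∀ W ≤ 3, ∀ a ≤ 3, ∀ b ≤ 3, ∃ τ ≤ 3,
    τ ≤ a ∧ τ ≤ b ∧ FP2.pairFloor 3 a b τ = W * a * b / 3 + τ * (3 - W) := by
  decide

variable {Λ : Type} [AddCommGroup Λ] [Fintype Λ]
variable {cap vmin SU SV SW : ℕ} {u v w : Λ → ℕ}

/-- Re-indexing along `g ↦ c − g`: `Σ_g f (c − g) = Σ_h f h`. [bookkeeping] -/
theorem sum_sub_left_eq (f : Λ → ℕ) (c : Λ) : ∑ g, f (c - g) = ∑ h, f h :=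
  Equiv.sum_comp (Equiv.subLeft c) f

/-- **(F1) at `p = 3`, closed form.**  For a target class `c` with `W` points: `Σ_g ⌊W·u_g·v_{c−g}/3⌋ ≤ W·cap`.
Proof: instantiate the level clause of `TargetOKG` at the levels of `three_key`, pointwise. [original] -/
theorem three_floor_sum_le {c : Λ} {W : ℕ} (hT : TargetOKG Λ 3 cap vmin u v c W) (hu : ∀ g, u g ≤ 3) (hv : ∀ g, v g ≤ 3) :
    ∑ g, W * u g * v (c - g) / 3 ≤ W * cap := by
  have hW : W ≤ 3 := hT.1
  choose τ _ hk using fun g => three_key W hW (u g) (hu g) (v (c - g)) (hv (c - g))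
  have h := hT.2.1 τ (fun g => ⟨(hk g).1, (hk g).2.1⟩)
  rw [sum_congr rfl (fun g _ => (hk g).2.2), sum_add_distrib, ← sum_mul] at h
  have hmin := Nat.mul_le_mul_left W (min_le_right (∑ g, τ g) cap)
  omega

/-- **Full target class** (`W = 3`): `Σ_g u_g·v_{c−g} ≤ 3·cap` (every pair sum lands on a target point; the rule is exact here). [original] -/
theorem three_prod_sum_le_of_full {c : Λ} (hT : TargetOKG Λ 3 cap vmin u v c 3) (hu : ∀ g, u g ≤ 3) (hv : ∀ g, v g ≤ 3) :
    ∑ g, u g * v (c - g) ≤ 3 * cap := by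
  have h := three_floor_sum_le hT hu hv
  have he : ∀ g, 3 * u g * v (c - g) / 3 = u g * v (c - g) := fun g => by
    rw [mul_assoc, Nat.mul_div_cancel_left _ (by norm_num)]
  rw [sum_congr rfl (fun g _ => he g)] at h
  exact h

/-- **Full target class, active pairs**: at most `3·cap` classes `g` with `u_g ≥ 1` and `v_{c−g} ≥ 1`. [original] -/
theorem three_active_le_of_full {c : Λ} (hT : TargetOKG Λ 3 cap vmin u v c 3) (hu : ∀ g, u g ≤ 3) (hv : ∀ g, v g ≤ 3) :
    (univ.filter (fun g => 1 ≤ u g ∧ 1 ≤ v (c - g))).card ≤ 3 * cap := by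
  rw [card_filter]
  refine le_trans (sum_le_sum fun g _ => ?_) (three_prod_sum_le_of_full hT hu hv)
  split_ifs with h
  · exact Nat.one_le_iff_ne_zero.mpr (Nat.mul_ne_zero (by omega) (by omega))
  · exact Nat.zero_le _

/-- **Target class of value `2`**: the pairs `(u_g ≥ 2, v_{c−g} ≥ 1)` and `(u_g ≥ 1, v_{c−g} ≥ 2)` number at most `2·cap` (a pair with both
`≥ 2` counts twice) — every such pair forces a surplus representation. [original] -/
theorem three_pairs_le_of_two {c : Λ} (hT : TargetOKG Λ 3 cap vmin u v c 2) (hu : ∀ g, u g ≤ 3) (hv : ∀ g, v g ≤ 3) :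
    (univ.filter (fun g => 2 ≤ u g ∧ 1 ≤ v (c - g))).card + (univ.filter (fun g => 1 ≤ u g ∧ 2 ≤ v (c - g))).card ≤ 2 * cap := by
  rw [card_filter, card_filter, ← sum_add_distrib]
  refine le_trans (sum_le_sum fun g _ => ?_) (three_floor_sum_le hT hu hv)
  have key : ∀ a ≤ 3, ∀ b ≤ 3,
      (if 2 ≤ a ∧ 1 ≤ b then 1 else 0) + (if 1 ≤ a ∧ 2 ≤ b then 1 else 0) ≤ 2 * a * b / 3 := by decide
  exact key (u g) (hu g) (v (c - g)) (hv (c - g))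

/-- **Target class of value `1`**: the pairs `(3, ≥1)`, `(≥1, 3)` and `(2,2)` number at most `cap`. [original] -/
theorem three_pairs_le_of_one {c : Λ} (hT : TargetOKG Λ 3 cap vmin u v c 1) (hu : ∀ g, u g ≤ 3) (hv : ∀ g, v g ≤ 3) :
    (univ.filter (fun g => u g = 3 ∧ 1 ≤ v (c - g))).card + (univ.filter (fun g => 1 ≤ u g ∧ v (c - g) = 3)).card +
      (univ.filter (fun g => u g = 2 ∧ v (c - g) = 2)).card ≤ cap := by
  rw [card_filter, card_filter, card_filter, ← sum_add_distrib, ← sum_add_distrib]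
  have h1 := three_floor_sum_le hT hu hv
  simp only [one_mul] at h1
  refine le_trans (sum_le_sum fun g _ => ?_) h1
  have key : ∀ a ≤ 3, ∀ b ≤ 3,
      (if a = 3 ∧ 1 ≤ b then 1 else 0) + (if 1 ≤ a ∧ b = 3 then 1 else 0) + (if a = 2 ∧ b = 2 then 1 else 0) ≤ a * b / 3 := by
    decide
  exact key (u g) (hu g) (v (c - g)) (hv (c - g))

/-! ### Global consequences for one letter form at `p = 3` -/

/-- The target letter of a form at `p = 3` takes values `≤ 3`. [bookkeeping] -/
theorem three_target_le (hF : FormOKG Λ 3 cap vmin SU SV SW u v w) (c : Λ) : w c ≤ 3 :=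
  (hF.2.2.2.2.2 c).1

omit [AddCommGroup Λ] in
/-- Layer-cake at `p = 3`: `Σ u = #{1 ≤ u} + #{2 ≤ u} + #{3 ≤ u}` for `u ≤ 3`. [bookkeeping] -/
theorem three_layer_cake (hu : ∀ g, u g ≤ 3) :
    ∑ g, u g = (univ.filter (fun g => 1 ≤ u g)).card + (univ.filter (fun g => 2 ≤ u g)).card +
      (univ.filter (fun g => 3 ≤ u g)).card := by
  rw [card_filter, card_filter, card_filter, ← sum_add_distrib, ← sum_add_distrib]
  refine sum_congr rfl fun g _ => ?_
  have := hu g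
  interval_cases u g <;> simp

omit [AddCommGroup Λ] in
/-- `#{1 ≤ u} + #{u = 0} = |Λ|`. [bookkeeping] -/
theorem card_supp_add_card_zero (u : Λ → ℕ) :
    (univ.filter (fun g => 1 ≤ u g)).card + (univ.filter (fun g => u g = 0)).card = Fintype.card Λ := by
  have h := card_filter_add_card_filter_not (s := (univ : Finset Λ)) (fun g => 1 ≤ u g)
  have he : univ.filter (fun g => ¬ 1 ≤ u g) = univ.filter (fun g => u g = 0) :=
    filter_congr fun g _ => by omega
  rw [he, card_univ] at h
  exact h

/-- If `SW > |Λ|` then some target class has value `≥ 2`. [bookkeeping] -/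
theorem three_exists_two_le (hF : FormOKG Λ 3 cap vmin SU SV SW u v w) (hSW : Fintype.card Λ < SW) : ∃ c, 2 ≤ w c := by
  by_contra h
  push Not at h
  have hs : ∑ c, w c ≤ ∑ _c : Λ, 1 := sum_le_sum fun c _ => Nat.le_of_lt_succ (h c)
  rw [sum_const, card_univ, smul_eq_mul, mul_one, hF.2.2.1] at hs
  omega

/-- **A FULL target class forces small supports** (K1): if some `w c = 3` then `#supp u + #supp v ≤ |Λ| + 3·cap` (the class `c` has at most
`3·cap` active pairs, and `g ↦ c − g` pairs the supports). [original] -/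
theorem three_supports_le_of_full (hF : FormOKG Λ 3 cap vmin SU SV SW u v w) {c : Λ} (hc : w c = 3) :
    (univ.filter (fun g => 1 ≤ u g)).card + (univ.filter (fun h => 1 ≤ v h)).card ≤ Fintype.card Λ + 3 * cap := by
  obtain ⟨-, -, -, hu, hv, hT⟩ := hF
  have hTc := hT c
  rw [hc] at hTc
  have hact := three_active_le_of_full hTc hu hv
  have hre : (univ.filter (fun h => 1 ≤ v h)).card = ∑ g, (if 1 ≤ v (c - g) then 1 else 0) := by
    rw [card_filter, ← sum_sub_left_eq (fun h => if 1 ≤ v h then 1 else 0) c]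
  rw [card_filter] at hact ⊢
  rw [hre]
  have hpt : ∀ g, (if 1 ≤ u g then 1 else 0) + (if 1 ≤ v (c - g) then 1 else 0) ≤
      1 + (if 1 ≤ u g ∧ 1 ≤ v (c - g) then 1 else 0) := fun g => by
    split_ifs <;> omega
  have := sum_le_sum fun g (_ : g ∈ univ) => hpt g
  simp only [sum_add_distrib, sum_const, card_univ, smul_eq_mul, mul_one] at this
  omega

/-- **A target class of value `2` forces full classes** (the «no `{0,1,2}`-valued solution» count): if some `w c = 2` then
`SU + SV ≤ 2|Λ| + 2·cap + #{u = 3} + #{v = 3}` — every class of `u` of value `≥ 2` facing a non-empty class of `v` (w.r.t. `c`) costs, and only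
the zeros of the partner absorb them. [original] -/
theorem three_totals_le_of_two (hF : FormOKG Λ 3 cap vmin SU SV SW u v w) {c : Λ} (hc : w c = 2) :
    SU + SV ≤ 2 * Fintype.card Λ + 2 * cap + (univ.filter (fun g => u g = 3)).card + (univ.filter (fun h => v h = 3)).card := by
  obtain ⟨hsu, hsv, -, hu, hv, hT⟩ := hF
  have hTc := hT c
  rw [hc] at hTc
  have hpairs := three_pairs_le_of_two hTc hu hv
  have hlu := three_layer_cake hu
  have hlv := three_layer_cake hv
  have hzu := card_supp_add_card_zero u
  have hzv := card_supp_add_card_zero v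
  rw [hsu] at hlu
  rw [hsv] at hlv
  -- `#{2 ≤ u} ≤ #pairs(≥2,≥1) + #{v = 0}` and symmetrically, via the bijection `g ↦ c − g`
  have h3u : univ.filter (fun g => 3 ≤ u g) = univ.filter (fun g => u g = 3) :=
    filter_congr fun g _ => by have := hu g; omega
  have h3v : univ.filter (fun h => 3 ≤ v h) = univ.filter (fun h => v h = 3) :=
    filter_congr fun h _ => by have := hv h; omega
  rw [h3u] at hlu
  rw [h3v] at hlv
  have hA : (univ.filter (fun g => 2 ≤ u g)).card ≤
      (univ.filter (fun g => 2 ≤ u g ∧ 1 ≤ v (c - g))).card + (univ.filter (fun h => v h = 0)).card := by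
    rw [card_filter, card_filter, card_filter, ← sum_sub_left_eq (fun h => if v h = 0 then 1 else 0) c, ← sum_add_distrib]
    exact sum_le_sum fun g _ => by split_ifs <;> omega
  have hB : (univ.filter (fun h => 2 ≤ v h)).card ≤
      (univ.filter (fun g => 1 ≤ u g ∧ 2 ≤ v (c - g))).card + (univ.filter (fun g => u g = 0)).card := by
    rw [card_filter, card_filter, card_filter, ← sum_sub_left_eq (fun h => if 2 ≤ v h then 1 else 0) c, ← sum_add_distrib]
    exact sum_le_sum fun g _ => by split_ifs <;> omega
  omega

/-- **A target class of value `1` bounds the full classes of the summands**: if some `w c = 1` then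
`#{u = 3} + #{v = 3} ≤ cap + #{u = 0} + #{v = 0}`. [original] -/
theorem three_fulls_le_of_one (hF : FormOKG Λ 3 cap vmin SU SV SW u v w) {c : Λ} (hc : w c = 1) :
    (univ.filter (fun g => u g = 3)).card + (univ.filter (fun h => v h = 3)).card ≤
      cap + (univ.filter (fun g => u g = 0)).card + (univ.filter (fun h => v h = 0)).card := by
  obtain ⟨-, -, -, hu, hv, hT⟩ := hF
  have hTc := hT c
  rw [hc] at hTc
  have hpairs := three_pairs_le_of_one hTc hu hv
  have hre3 : (univ.filter (fun h => v h = 3)).card = ∑ g, (if v (c - g) = 3 then 1 else 0) := by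
    rw [card_filter, ← sum_sub_left_eq (fun h => if v h = 3 then 1 else 0) c]
  have hre0 : (univ.filter (fun h => v h = 0)).card = ∑ g, (if v (c - g) = 0 then 1 else 0) := by
    rw [card_filter, ← sum_sub_left_eq (fun h => if v h = 0 then 1 else 0) c]
  rw [hre3, hre0, card_filter, card_filter]
  rw [card_filter, card_filter, card_filter] at hpairs
  have hpt : ∀ g, (if u g = 3 then 1 else 0) + (if v (c - g) = 3 then 1 else 0) ≤
      ((if u g = 3 ∧ 1 ≤ v (c - g) then 1 else 0) + (if 1 ≤ u g ∧ v (c - g) = 3 then 1 else 0) +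
        (if u g = 2 ∧ v (c - g) = 2 then 1 else 0)) +
      (if u g = 0 then 1 else 0) + (if v (c - g) = 0 then 1 else 0) := fun g => by
    split_ifs <;> omega
  have := sum_le_sum fun g (_ : g ∈ univ) => hpt g
  simp only [sum_add_distrib] at this
  omega

/-- **No solution without a full class.**  If `|Λ| < SW` and `2|Λ| + 2·cap < SU + SV` then a triple `(u, v, w)` passing the form at
`p = 3` cannot have all values `≤ 2`: by `three_exists_two_le` some target class has value `2`, and `three_totals_le_of_two` with no class of
value `3` contradicts the totals. [original] -/
theorem three_false_of_no_full (hF : FormOKG Λ 3 cap vmin SU SV SW u v w) (hSW : Fintype.card Λ < SW)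
    (hS : 2 * Fintype.card Λ + 2 * cap < SU + SV) (hu2 : ∀ g, u g ≤ 2) (hv2 : ∀ g, v g ≤ 2) (hw2 : ∀ g, w g ≤ 2) : False := by
  obtain ⟨c, hc⟩ := three_exists_two_le hF hSW
  have hc2 : w c = 2 := le_antisymm (hw2 c) hc
  have h := three_totals_le_of_two hF hc2
  have hu0 : (univ.filter (fun g => u g = 3)).card = 0 :=
    card_eq_zero.mpr (filter_eq_empty_iff.mpr fun g _ => by have := hu2 g; omega)
  have hv0 : (univ.filter (fun h => v h = 3)).card = 0 :=
    card_eq_zero.mpr (filter_eq_empty_iff.mpr fun h _ => by have := hv2 h; omega)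
  omega

/-- The same, stated positively: some class of `u`, `v` or `w` is full (`= 3`). [original] -/
theorem three_exists_full (hF : FormOKG Λ 3 cap vmin SU SV SW u v w) (hSW : Fintype.card Λ < SW)
    (hS : 2 * Fintype.card Λ + 2 * cap < SU + SV) : ∃ g, u g = 3 ∨ v g = 3 ∨ w g = 3 := by
  by_contra h
  push Not at h
  have hu := hF.2.2.2.1
  have hv := hF.2.2.2.2.1
  refine three_false_of_no_full hF hSW hS (fun g => ?_) (fun g => ?_) (fun g => ?_)
  · have := hu g; have := (h g).1; omega
  · have := hv g; have := (h g).2.1; omega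
  · have := three_target_le hF g; have := (h g).2.2; omega

/-! ### Read on `AdmG` at `M = 3·|Λ|` -/

variable {N : ℕ}

/-- **Every FP3-admissible split has a full class.**  If `AdmG Λ M a b c` holds at `M = 3·|Λ|` and the shapes satisfy `|Λ| < Σ c a` and
`2|Λ| + 2·max b < Σ a b + Σ b c`, then the admissible class counts `(x, y, z)` it provides (at the trivial lower bounds) pass the three
letter forms and have a FULL class: a coset of the order-`3` subgroup lying entirely inside `X`, `Y` or `Z′`.  (By `three_supports_le_of_full`
such a class forces the supports of the other two letters, read through the form it is the target of, to total at most `|Λ| + 3·cap`.)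
[original] -/
theorem admG_three_exists_full {M : ℕ} {a b c : Fin N → ℕ} (hA : AdmG Λ M a b c) (hM : M = Fintype.card Λ * 3)
    (hq : Fintype.card Λ < pCA a b c) (hS : 2 * Fintype.card Λ + 2 * univ.sup b < pAB a b c + pBC a b c) :
    ∃ x y z : Λ → ℕ,
      FormOKG Λ 3 (univ.sup b) 0 (pAB a b c) (pBC a b c) (pCA a b c) x y z ∧
      FormOKG Λ 3 (univ.sup a) 0 (pCA a b c) (pAB a b c) (pBC a b c) (fun g => z (-g)) x (fun g => y (-g)) ∧
      FormOKG Λ 3 (univ.sup c) 0 (pBC a b c) (pCA a b c) (pAB a b c) y (fun g => z (-g)) (fun g => x (-g)) ∧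
      ∃ g, x g = 3 ∨ y g = 3 ∨ z g = 3 := by
  obtain ⟨x, y, z, hB, hA', hC⟩ :=
    hA 3 hM Nat.prime_three 0 0 0 (fun _ => Nat.zero_le _) (fun _ => Nat.zero_le _) (fun _ => Nat.zero_le _)
  exact ⟨x, y, z, hB, hA', hC, three_exists_full hB hq hS⟩

end FPQ

end Summit.MatrixMultiplication.MatrixMultiplication.Theorems
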